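import Summits.FinalStateConjecture.FinalStateConjecture.Theses.StarvedNecks

/-!
# Route StarvedNecks — crux `GapDecaySuffices` (stmt-FinalStateConjecture-18060), line `Sketch`: stub S1 `stub_gapBootstrap`

`stub_gapBootstrap : NeckGapDecay → GapBootstrap` — the RE-EXCISION BOOTSTRAP of the line skeleton
`Cruxes/GapDecaySuffices/Lines/Sketch.lean`, stated with the skeleton's bundles `HonestCore`, `HonestFar`,
`DistinctVelocities`, `GapCertificateAt`, `GapBootstrap` inlined verbatim as `let`s (a Theorems file cannot
import the Cruxes workfile; the lead closes the skeleton stub by `exact stub_gapBootstrap`, `let`/δ-unfolding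
being definitional).

PROOF.  `NeckGapDecay` quantifies over ALL honest `C⁴` decompositions.  Given the input `d`, a hole `i` and a
sublinear profile `ρ'`, feed it the RE-EXCISED decomposition `d''` with the same `N`, masses, spins, motions,
`τ₀`, hole charts, flat domain, flat chart, convergence and covering clauses as `d`, but excision radii
`ρ''ⱼ := max ρⱼ ρ'` (sublinear as a `max` of sublinear profiles; pointwise `≥ ρⱼ`, so the flat-domain clause
`setOf_lt_excision_subset_flatDomain` follows from that of `d` by monotonicity).  Then `d''.charted`,
`d''.background`, `d''.chart` are those of `d` definitionally, so `O = exteriorOf 𝒟 d''.charted`,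
`HonestCore`, distinct velocities transfer literally, and `HonestFar` transfers except its clause (2), which is
ANTITONE in the excision (`closure_mono ∘ image_subset`).  The gap certificate of `d''` at hole `i` has wall
`W ≥ 3 max(ρᵢ, ρ') + 2 ≥ 3ρ' + 2`, and its clauses G1–G5 are literally those of the goal (they do not
mention the excision).  No definitions, no named facts, no `sorry`.
References: DHRT arXiv:2104.08222 §1 (multi-black-hole final-state picture); O'Neill 1983, Ch. 14.
-/

noncomputable section

open scoped Manifold ContDiff Topology ENNReal
open Filter Set MeasureTheory Topology Literature.Geometry.Lorentzian

namespace Summit.FinalStateConjecture.FinalStateConjecture.Theorems.GapDecaySuffices.Bootstrap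

set_option linter.dupNamespace false

/-- **Registered stub S1 `stub_gapBootstrap`** of line `Sketch` of the crux `GapDecaySuffices`:
`NeckGapDecay → GapBootstrap` (bundles of the skeleton inlined as `let`s).  For every honest `C⁴` input with
distinct velocities, every hole `i` and every sublinear profile `ρ'`, the gap certificate of hole `i` holds
above the wall profile `3ρ' + 2` — by `NeckGapDecay` applied to the re-excised decomposition with excision
radii `max ρⱼ ρ'` (DHRT arXiv:2104.08222 §1 for the multi-hole picture). [folklore] -/
theorem stub_gapBootstrap :
    let HonestCore := fun (𝓢 : Spacetime.{0} 4) (O : Set 𝓢.carrier) (k : ℕ)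
        (d : FinalStateDecomposition 𝓢 O k) (R₀ : ℝ) ↦
      let B := d.background; let t := fun i ↦ (B i).time; let r := fun i ↦ (B i).radius; let Ψ := d.chart;
      (∀ i, Kerr.IsSubextremal (d.mass i) (d.spin i) ∧ 100 * d.mass i ≤ R₀ ∧ 0 < ((d.motion i).1 : E4 ≃L[ℝ] E4) (E4.basisVector 0) 0) ∧
        (∀ i (ϱ τ₂ : ℝ), R₀ ≤ ϱ → d.τ₀ < τ₂ → Ψ i '' {x | d.τ₀ < t i x.1 ∧ t i x.1 < τ₂ ∧ r i x.1 < ϱ} ⊆ 𝓢.metric.causalPast 𝓢.timeOrientation (Ψ i '' (B i).truncTimeSlab ϱ τ₂)) ∧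
        (∀ i (τ' : ℝ) (ϱ : ℝ → ℝ), Continuous ϱ → d.τ₀ < τ' → let A := Ψ i '' {x | τ' ≤ t i x.1 ∧ r i x.1 ≤ ϱ (t i x.1)}; closure A ∩ O ⊆ A) ∧
        (∀ y : d.flatDomain, d.τ₀ < y.1 0 → 𝓢.timeOrientation.IsFutureDirected (mfderiv 𝓘(ℝ, E4) (𝓡 4) d.flatChart y (E4.basisVector 0)))
    let HonestFar := fun (𝓢 : Spacetime.{0} 4) (O : Set 𝓢.carrier) (k : ℕ)
        (d : FinalStateDecomposition 𝓢 O k) (R₀ : ℝ) ↦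
      let B := d.background; let t := fun i ↦ (B i).time; let r := fun i ↦ (B i).radius; let Φ := d.flatChart;
      (∀ τ₂ : ℝ, d.τ₀ < τ₂ → Φ '' {y | d.τ₀ < y.1 0 ∧ y.1 0 < τ₂} ⊆ 𝓢.metric.causalPast 𝓢.timeOrientation (Φ '' (Minkowski.backgroundOn d.flatDomain).timeSlab τ₂)) ∧
        (∀ τ' : ℝ, d.τ₀ < τ' → closure (Φ '' {y | τ' ≤ y.1 0 ∧ ∀ i, d.excision i (y.1 0) + 1 ≤ r i y.1}) ⊆ Φ '' {y | τ' ≤ y.1 0}) ∧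
        (∀ i, ∃ T : ℝ, supCkENorm (Subtype.val '' {x : (B i).domain | T ≤ t i x.1 ∧ R₀ ≤ r i x.1 ∧ ∀ j, j ≠ i → r i x.1 ≤ r j x.1}) 0 (𝓢.deviationExtend (B i) (d.chart i)) ≤ ENNReal.ofReal (1 / (10 * ‖(((d.motion i).1 : E4 ≃L[ℝ] E4) : E4 →L[ℝ] E4)‖ ^ 2)))
    let DistinctVelocities := fun (𝓢 : Spacetime.{0} 4) (O : Set 𝓢.carrier) (k : ℕ)
        (d : FinalStateDecomposition 𝓢 O k) ↦
      ∀ i j : Fin d.N, i ≠ j →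
        ((d.motion i).1 : E4 ≃L[ℝ] E4) (E4.basisVector 0) ≠ ((d.motion j).1 : E4 ≃L[ℝ] E4) (E4.basisVector 0)
    let GapCertificateAt := fun (𝓢 : Spacetime.{0} 4) (O : Set 𝓢.carrier)
        (d : FinalStateDecomposition 𝓢 O 4) (R₀ : ℝ) (i : Fin d.N) (w : ℝ → ℝ) ↦
      ∃ (R₁ τ₁ : ℝ) (W : ℝ → ℝ) (Ψg : (d.background i).domain → 𝓢.carrier),
        let B := d.background i; let t := B.time; let r := B.radius;
        R₀ ≤ R₁ ∧ d.τ₀ ≤ τ₁ ∧ Continuous W ∧ (∀ s, τ₁ ≤ s → w s ≤ W s) ∧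
        (let U : Set B.domain := {x | τ₁ < t x.1 ∧ r x.1 < W (x.1 0) + 1};
          ContMDiffOn 𝓘(ℝ, E4) (𝓡 4) ∞ Ψg U ∧ Topology.IsOpenEmbedding (U.restrict Ψg) ∧ Ψg '' U ⊆ d.charted) ∧
        (∀ x : B.domain, r x.1 ≤ R₁ + 1 → Ψg x = d.chart i x) ∧
        Tendsto (fun τ ↦ supCkENorm (Subtype.val '' {x : B.domain | t x.1 = τ ∧ r x.1 ≤ W (x.1 0)}) 2
          (𝓢.deviationExtend B Ψg)) atTop (𝓝 0) ∧
        (∀ x : B.domain, τ₁ ≤ t x.1 → R₁ ≤ r x.1 → r x.1 ≤ W (x.1 0) →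
          𝓢.timeOrientation.IsFutureDirected
            (mfderiv 𝓘(ℝ, E4) (𝓡 4) Ψg x (((d.motion i).1 : E4 ≃L[ℝ] E4) (E4.basisVector 0)))) ∧
        (∀ (τ' : ℝ) (ϱ : ℝ → ℝ), Continuous ϱ → τ₁ < τ' →
          (∀ x : B.domain, τ' ≤ t x.1 → r x.1 ≤ ϱ (t x.1) → r x.1 ≤ W (x.1 0)) →
          closure (Ψg '' {x | τ' ≤ t x.1 ∧ r x.1 ≤ ϱ (t x.1)}) ∩ O ⊆ Ψg '' {x | τ' ≤ t x.1 ∧ r x.1 ≤ ϱ (t x.1)})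
    let GapBootstrap : Prop :=
      ∀ (X : Type) [TopologicalSpace X] [ChartedSpace E3 X] [IsManifold (𝓡 3) ∞ X] [ConnectedSpace X]
        (D : InitialDataSet (𝓡 3) X), D ∈ admissibleVacuumData X →
        ∀ 𝒟 : VacuumCauchyDevelopment D, 𝒟.IsMaximal →
        ∀ (O : Set 𝒟.carrier) (d : FinalStateDecomposition 𝒟.toSpacetime O 4) (R₀ : ℝ),
          O = exteriorOf 𝒟.toCauchyDevelopment d.charted →
          HonestCore 𝒟.toSpacetime O 4 d R₀ → HonestFar 𝒟.toSpacetime O 4 d R₀ →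
          DistinctVelocities 𝒟.toSpacetime O 4 d →
          ∀ (i : Fin d.N) (ρ' : ℝ → ℝ) (τm : ℝ), (∀ s, τm ≤ s → d.excision i s ≤ ρ' s) →
            Tendsto (fun s ↦ ρ' s / s) atTop (𝓝 0) →
            GapCertificateAt 𝒟.toSpacetime O d R₀ i (fun s ↦ 3 * ρ' s + 2)
    Theses.StarvedNecks.NeckGapDecay → GapBootstrap := by
  intro HonestCore HonestFar DistinctVelocities GapCertificateAt GapBootstrap hGap X _ _ _ _ D hD 𝒟 h𝒟 O d R₀
    hO hc hf hdv i ρ' _τm _hρ' hsub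
  -- the re-excised decomposition: excision radii `max ρⱼ ρ'`, everything else as in `d`
  let d'' : FinalStateDecomposition 𝒟.toSpacetime O 4 :=
    { d with
      excision := fun j s ↦ max (d.excision j s) (ρ' s)
      tendsto_excision_div := fun j ↦ by
        have h := (d.tendsto_excision_div j).max hsub
        rw [max_self] at h
        refine h.congr' ?_
        filter_upwards [eventually_ge_atTop (0 : ℝ)] with s hs
        exact max_div_div_right hs _ _
      setOf_lt_excision_subset_flatDomain := fun x hx ↦
        d.setOf_lt_excision_subset_flatDomain ⟨hx.1, fun j ↦ (le_max_left _ _).trans_lt (hx.2 j)⟩ }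
  -- `HonestFar` for `d''`: clause (2) is antitone in the excision, the other two do not mention it
  obtain ⟨hf1, hf2, hf3⟩ := hf
  have hf'' : HonestFar 𝒟.toSpacetime O 4 d'' R₀ := by
    refine ⟨hf1, fun τ' hτ' ↦ (closure_mono (image_mono fun y hy ↦ ?_)).trans (hf2 τ' hτ'), hf3⟩
    exact ⟨hy.1, fun j ↦ (add_le_add (le_max_left _ (ρ' (y.1 0))) le_rfl).trans (hy.2 j)⟩
  -- the gap certificate of `d''` at hole `i`
  obtain ⟨R₁, τ₁, W, Ψg, hR₁, hτ₁, hW, hwall, hrest⟩ := hGap X D hD 𝒟 h𝒟 O d'' R₀ hO hc hf'' hdv i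
  refine ⟨R₁, τ₁, W, Ψg, hR₁, hτ₁, hW, fun s hs ↦ ?_, hrest⟩
  have h := hwall s hs
  have hm := le_max_right (d.excision i s) (ρ' s)
  change 3 * max (d.excision i s) (ρ' s) + 2 ≤ W s at h
  linarith

end Summit.FinalStateConjecture.FinalStateConjecture.Theorems.GapDecaySuffices.Bootstrap

end
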